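import Summits.NavierStokesRegularity.NavierStokesRegularity.Theorems.ScenarioCensusHullMeterDials
import Summits.NavierStokesRegularity.NavierStokesRegularity.Theorems.TypeIQuarterGateScarEnvelopeTypeINearOneRateDss
import HarnessLib

/-!
# HULL METER port, part 3/4: §G the COARSE dial (typed OPEN, calibrated against the coarse DSS Liouville = census D7, past form); §H the census rows `Row_A2huN` / `S` / `R` / `F` / `L` / `C`, nestings,
# calibration, feed from the rung; §G′ (REV 2) the DEFECT dial (`Row_A2huD` / `Row_A2huDf` DECIDED, `Row_A2huDL` OPEN ≡ D7)

Re-homed for the scenario census (typer seat ns-census-typer-1 g10; the cells A2huN / A2huS / A2huR / A2huF / A2huC / A2huD / A2huDf / A2hu2c are MEMBERS OF RECORD «DECIDED IN KERNEL IN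
FILES» of row A2 (item 76: REV 1 critic PASS, REV 3 idea-crit-3 g10 ROW WORDS BY KEY 11:55:14Z; ref PRE-CHECK ✓ §18.33; lead label LBL76r3), A2huL / A2huDL OPEN ≡ D7
(`CoarsePastLiouville`); this port makes the decided cells TREE-decided): VERBATIM PORT of ns-idea-2 LINE g17-1 «hull-meter» REV 3,
`pub/ideators/ns-idea-2/lines/hull-meter/line-hull-meter.rev3.lean` sha16 ab921f346883452d (1125 l., lean check rc 0, 0 sorry), split for the 400-line rule into
`ScenarioCensusHullMeter` (§A–§C) → `…HullMeterDials` (§D–§F) → `…HullMeterRows` (§G, §H, §G′) → `…HullMeterTwoCentre` (§G″, §I + census KEYS).  Lean text VERBATIM in namespace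
`…Theorems.ScenarioCensus.HullMeter` (the line's `…Lines.HullMeter` re-homed); port edits: the line's `local notation "E3"` is spelled as the reducible `abbrev E3` of every census
file; the line's import of the crux workfile `Cruxes/ScarEnvelopeTypeI/Lines/axis_activity` is replaced by its landed Theorems home
`Theorems.TypeIQuarterGateScarEnvelopeTypeINearOneRateDss` (same namespace `…Cruxes.ScarEnvelopeTypeI.AxisActivity`, same names `NearOneRateDss` / `nearOneRateDss_proof` /
`isDiscretelySelfSimilar_pow`); `set_option linter.unusedVariables false` dropped (binders the linter names are `_`-prefixed); `@[conjecture]` on the OPEN statements `CoarsePastLiouville`,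
`CoarseGapLaw`, `Row_A2huL`, `Row_A2huDL` (≡ census D7, OPEN); one-line docstrings added where missing (gate lint).  Statements untouched.

No census VALUE is moved here (row A2 stays OPEN-WITH-LINE; the members become TREE-decided by name); D7 / (L′) are NOT proved; no summit statement is proved by this file.
-/

-- the summit and its single problem share the name `NavierStokesRegularity` (D-0017 nested layout)
set_option linter.dupNamespace false

noncomputable section

open Set Function Filter Metric
open scoped Topology
open Literature.Analysis Literature.Analysis.FluidPDE
open Summit.NavierStokesRegularity.NavierStokesRegularity.Theorems
open Summit.NavierStokesRegularity.NavierStokesRegularity.Theorems.ScenarioCensus.ScrewBlowdown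
open Summit.NavierStokesRegularity.NavierStokesRegularity.Theorems.ScenarioCensus.ScalingSpectrum
open Summit.NavierStokesRegularity.NavierStokesRegularity.Theorems.PoloidalWindowDoorPoloidalWindowRigidityStrata
open Summit.NavierStokesRegularity.NavierStokesRegularity.Cruxes.ScarEnvelopeTypeI.AxisActivity
open Literature.ComputerArithmetic.BrentZimmermann2010.CommensurableBases

namespace Summit.NavierStokesRegularity.NavierStokesRegularity.Theorems.ScenarioCensus.HullMeter

variable {C : ℝ} {u : ℝ → E3 → E3}

/-! ## G. The COARSE dial: typed OPEN, and calibrated against the coarse DSS Liouville (census D7, past form) -/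

/-- **COARSE PAST LIOUVILLE** (census D7 shape, time-rate class, stated on the past): for EVERY factor `λ₀ > 1` and every
`C`, a field of `A_C` invariant on the past under the zoom by `λ₀` vanishes on the past.  OPEN (typed, not claimed). -/
@[conjecture] def CoarsePastLiouville : Prop := ∀ (C lam : ℝ), 1 < lam → PastLiouville C {lam}

/-- Global-DSS form of the same statement (the tree's `NearOneRateDss` with the threshold removed). -/
theorem coarsePastLiouville_iff_dss :
    CoarsePastLiouville ↔ ∀ (C lam : ℝ), 1 < lam → ∀ u : ℝ → E3 → E3, IsTypeIAncientMild C u →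
      IsDiscretelySelfSimilar lam u → ∀ t < (0 : ℝ), ∀ x, u t x = 0 := by
  constructor
  · intro h C lam hlam u hu hdss t ht x
    have e : nsRescale lam u = u := hdss
    exact h C lam hlam u hu (fun c hc t ht x => by rw [mem_singleton_iff] at hc; subst hc; rw [e]) t ht x
  · intro h C lam hlam W hW hinv t ht x
    have hz := h C lam hlam (pastPart W) (isTypeIAncientMild_pastPart hW)
      (isDiscretelySelfSimilar_pastPart (one_pos.trans hlam) (hinv lam rfl)) t ht x
    rwa [pastPart_of_neg ht] at hz

/-- **COARSE GAP LAW** (single coarse factor): OPEN; PROVED EQUIVALENT to the coarse past Liouville (below). -/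
@[conjecture] def CoarseGapLaw : Prop :=
  ∀ (C lam : ℝ), 1 < lam → ∃ δ : ℝ, 0 < δ ∧ ∀ u : ℝ → E3 → E3, IsTypeIAncientMild C u →
    (∃ t < (0 : ℝ), ∃ x, u t x ≠ 0) → ∃ μ₁ : ℝ, 0 < μ₁ ∧ ∀ μ : ℝ, μ₁ ≤ μ →
      ∃ x : E3, ‖x‖ < 1 ∧ δ < ‖nsRescale (lam * μ) u (-1) x - nsRescale μ u (-1) x‖

/-- The coarse gap law is EXACTLY the coarse past Liouville theorem. -/
theorem coarseGapLaw_iff : CoarseGapLaw ↔ CoarsePastLiouville := by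
  constructor
  · intro h C lam hlam W hW hinv
    by_contra hne
    push Not at hne
    obtain ⟨t₀, ht₀, x₀, hx₀⟩ := hne
    obtain ⟨δ, hδ, G⟩ := h C lam hlam
    obtain ⟨μ₁, hμ₁, G1⟩ := G W hW ⟨t₀, ht₀, x₀, hx₀⟩
    obtain ⟨x, -, hgap⟩ := G1 μ₁ le_rfl
    have hμt : μ₁ ^ 2 * (-1 : ℝ) < 0 := mul_neg_of_pos_of_neg (by positivity) (by norm_num)
    have e : nsRescale (lam * μ₁) W (-1) x = nsRescale μ₁ W (-1) x := by
      rw [nsRescale_mul, nsRescale_apply, hinv lam rfl _ hμt, ← nsRescale_apply]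
    rw [e, sub_self, norm_zero] at hgap
    exact absurd hgap (not_lt.2 hδ.le)
  · intro h C lam hlam
    obtain ⟨δ, hδ, G⟩ := universal_gap (C := C) (F := {lam}) (by simpa using one_pos.trans hlam) (h C lam hlam)
    refine ⟨δ, hδ, fun u hu hne => ?_⟩
    obtain ⟨μ₁, hμ₁, G1⟩ := G u hu hne
    refine ⟨μ₁, hμ₁, fun μ hμ => ?_⟩
    obtain ⟨c, hc, x, hx, hgap⟩ := G1 μ hμ
    rw [mem_singleton_iff] at hc
    subst hc
    exact ⟨x, hx, hgap⟩

/-! ## H. The census rows (L′-shape, BY NAME over `IsTypeIAncientMild`), nestings, calibration, feed from the rung -/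

/-- **Row A2huN** («ℕ-convergent blow-down»): integer zooms converging on one slice-germ ⇒ `u ≡ 0`. DECIDED (`row_A2huN_holds`). -/
def Row_A2huN : Prop :=
  ∀ (C : ℝ) (u : ℝ → E3 → E3), IsTypeIAncientMild C u →
    (∃ t₀ < (0 : ℝ), ∃ U : Set E3, IsOpen U ∧ U.Nonempty ∧ ∃ w : E3 → E3,
      ∀ x ∈ U, Tendsto (fun n : ℕ => nsRescale (n : ℝ) u t₀ x) atTop (𝓝 (w x))) →
    ∀ t < (0 : ℝ), ∀ x, u t x = 0

/-- **Row A2huS** («×2,×3-stable convergent blow-down», e.g. along `{2ᵃ3ᵇ}`). DECIDED (`row_A2huS_holds`). -/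
def Row_A2huS : Prop :=
  ∀ (C : ℝ) (u : ℝ → E3 → E3), IsTypeIAncientMild C u →
    (∃ S : Set ℝ, (∀ M : ℝ, ∃ s ∈ S, M ≤ s) ∧ (∀ s ∈ S, 2 * s ∈ S) ∧ (∀ s ∈ S, 3 * s ∈ S) ∧
      ∃ t₀ < (0 : ℝ), ∃ U : Set E3, IsOpen U ∧ U.Nonempty ∧ ∃ w : E3 → E3,
        ∀ x ∈ U, Tendsto (fun s : ℝ => nsRescale s u t₀ x) (atTop ⊓ 𝓟 S) (𝓝 (w x))) →
    ∀ t < (0 : ℝ), ∀ x, u t x = 0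

/-- **Row A2huR** («asymptotically self-similar blow-down»: full convergence `μ → ∞` on one slice-germ). DECIDED. -/
def Row_A2huR : Prop :=
  ∀ (C : ℝ) (u : ℝ → E3 → E3), IsTypeIAncientMild C u →
    (∃ t₀ < (0 : ℝ), ∃ U : Set E3, IsOpen U ∧ U.Nonempty ∧ ∃ w : E3 → E3,
      ∀ x ∈ U, Tendsto (fun s : ℝ => nsRescale s u t₀ x) atTop (𝓝 (w x))) →
    ∀ t < (0 : ℝ), ∀ x, u t x = 0

/-- **Row A2huF** («fine-lacunary convergent blow-down», `1 < λ₀ < c₁(C)`, threshold from census D5r). DECIDED. -/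
def Row_A2huF : Prop :=
  ∀ C : ℝ, ∃ c₁ : ℝ, 1 < c₁ ∧ ∀ u : ℝ → E3 → E3, IsTypeIAncientMild C u →
    (∃ lam : ℝ, 1 < lam ∧ lam < c₁ ∧ ∃ t₀ < (0 : ℝ), ∃ U : Set E3, IsOpen U ∧ U.Nonempty ∧ ∃ w : E3 → E3,
      ∀ x ∈ U, Tendsto (fun k : ℕ => nsRescale (lam ^ k) u t₀ x) atTop (𝓝 (w x))) →
    ∀ t < (0 : ℝ), ∀ x, u t x = 0

/-- **Row A2huL** («coarse-lacunary convergent blow-down», ANY `λ₀ > 1`). OPEN — `↔ CoarsePastLiouville` (`row_A2huL_iff`). -/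
@[conjecture] def Row_A2huL : Prop :=
  ∀ (C : ℝ) (u : ℝ → E3 → E3), IsTypeIAncientMild C u →
    (∃ lam : ℝ, 1 < lam ∧ ∃ t₀ < (0 : ℝ), ∃ U : Set E3, IsOpen U ∧ U.Nonempty ∧ ∃ w : E3 → E3,
      ∀ x ∈ U, Tendsto (fun k : ℕ => nsRescale (lam ^ k) u t₀ x) atTop (𝓝 (w x))) →
    ∀ t < (0 : ℝ), ∀ x, u t x = 0

/-- **Row A2huC** («countable blow-down hull», modulo the past). DECIDED (`row_A2huC_holds`). -/
def Row_A2huC : Prop :=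
  ∀ (C : ℝ) (u : ℝ → E3 → E3), IsTypeIAncientMild C u → (pastHull C u).Countable → ∀ t < (0 : ℝ), ∀ x, u t x = 0

/-- **Row A2huN holds.** -/
theorem row_A2huN_holds : Row_A2huN := fun _ _ hu ⟨_, ht₀, _, hU, hne, _, hconv⟩ =>
  eq_zero_of_zoomsConverge_nat hu ht₀ hU hne hconv

/-- **Row A2huS holds.** -/
theorem row_A2huS_holds : Row_A2huS := fun _ _ hu ⟨_, hS, h2, h3, _, ht₀, _, hU, hne, _, hconv⟩ =>
  eq_zero_of_zoomsConverge_smooth hu hS h2 h3 ht₀ hU hne hconv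

/-- **Row A2huR holds.** -/
theorem row_A2huR_holds : Row_A2huR := fun _ _ hu ⟨_, ht₀, _, hU, hne, _, hconv⟩ =>
  eq_zero_of_zoomsConverge_real hu ht₀ hU hne hconv

/-- **Row A2huF holds.** -/
theorem row_A2huF_holds : Row_A2huF := fun C => by
  obtain ⟨c₁, hc₁, H⟩ := eq_zero_of_zoomsConverge_fineLacunary C
  exact ⟨c₁, hc₁, fun u hu ⟨lam, h1, h2, t₀, ht₀, U, hU, hne, w, hconv⟩ =>
    H lam h1 h2 u hu t₀ ht₀ U hU hne w hconv⟩

/-- **Row A2huC holds.** -/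
theorem row_A2huC_holds : Row_A2huC := fun _ _ hu hc => eq_zero_of_countable_pastHull hu hc

/-- NESTING (formal): the real row and the ℕ row are instances of the ×2,×3-stable row's mechanism; recorded as implications. -/
theorem row_A2huR_of_row_A2huS (h : Row_A2huS) : Row_A2huR := fun C u hu ⟨t₀, ht₀, U, hU, hne, w, hconv⟩ =>
  h C u hu ⟨univ, fun M => ⟨M, mem_univ _, le_rfl⟩, fun _ _ => mem_univ _, fun _ _ => mem_univ _,
    t₀, ht₀, U, hU, hne, w, fun x hx => by rw [principal_univ, inf_top_eq]; exact hconv x hx⟩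

/-- Nesting: the coarse row implies the fine row. -/
theorem row_A2huL_of_coarse : Row_A2huL → Row_A2huF := fun h C =>
  ⟨2, one_lt_two, fun u hu ⟨lam, h1, _, rest⟩ => h C u hu ⟨lam, h1, rest⟩⟩

/-- **CALIBRATION: the coarse-lacunary row is EXACTLY the coarse past Liouville theorem** (census D7, past form). -/
theorem row_A2huL_iff : Row_A2huL ↔ CoarsePastLiouville := by
  constructor
  · intro h C lam hlam W hW hinv t ht x
    -- the past truncation is globally `λ₀`-DSS: its lacunary zooms are CONSTANT, so they converge on any germ
    have hV := isTypeIAncientMild_pastPart hW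
    have hdss : ∀ k : ℕ, nsRescale (lam ^ k) (pastPart W) = pastPart W := fun k =>
      Cruxes.ScarEnvelopeTypeI.AxisActivity.isDiscretelySelfSimilar_pow
        (isDiscretelySelfSimilar_pastPart (one_pos.trans hlam) (hinv lam rfl)) k
    have hz := h C (pastPart W) hV ⟨lam, hlam, -1, by norm_num, univ, isOpen_univ, univ_nonempty,
      pastPart W (-1), fun x _ => by simp_rw [hdss]; exact tendsto_const_nhds⟩ t ht x
    rwa [pastPart_of_neg ht] at hz
  · intro h C u hu ⟨lam, hlam, t₀, ht₀, U, hU, hne, w, hconv⟩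
    have hpos : 0 < lam := one_pos.trans hlam
    have hmono : StrictMono (fun k : ℕ => lam ^ k) :=
      strictMono_nat_of_lt_succ fun k => by
        show lam ^ k < lam ^ (k + 1)
        rw [pow_succ]; exact lt_mul_of_one_lt_right (pow_pos hpos k) hlam
    refine eq_zero_of_zoomsConverge (F := {lam}) (by simpa using hpos) (h C lam hlam) hu
      (S := range (fun k : ℕ => lam ^ k)) (fun M => ?_) ?_ ht₀ hU hne (w := w) fun x hx => ?_
    · obtain ⟨k, hk⟩ := pow_unbounded_of_one_lt M hlam
      exact ⟨lam ^ k, ⟨k, rfl⟩, hk.le⟩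
    · rintro c hc _ ⟨k, rfl⟩
      rw [mem_singleton_iff] at hc
      subst hc
      exact ⟨k + 1, by show c ^ (k + 1) = c * c ^ k; rw [pow_succ, mul_comm]⟩
    · have h1 : Tendsto (fun s : ℝ => nsRescale s u t₀ x) (map (fun k : ℕ => lam ^ k) atTop) (𝓝 (w x)) :=
        tendsto_map'_iff.2 (hconv x hx)
      exact h1.mono_left (inf_principal_range_le_map hmono)

/-! ## G′. (REV 2) The DEFECT dial: finite differences in scale tending to zero along ONE sequence kill the element

REV 1 read CONVERGENCE of the zooms along structured scale SETS (ℕ, ×2×3-stable, lacunary) and a universal sup-GAP on `B₁ × {−1}`.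
REV 2 reads only FINITE DIFFERENCES IN SCALE, POINTWISE, ALONG ONE ARBITRARY SEQUENCE: if along SOME `sₖ → ∞` the defects
`u_{c sₖ}(t₀, x) − u_{sₖ}(t₀, x)` tend to `0` for the factors `c` of a past-Liouville set `F` and the points `x` of ONE germ
of ONE slice, then `u ≡ 0` — NO convergence of the zooms is assumed and NO arithmetic structure of the scale sequence is
needed (the structure moved entirely into the factor set `F`).  Mechanism: extract a hull member `W` along a subsequence;
the `c`-dilated subsequence converges to the `c`-zoom of `W` (zoom dictionary) AND, by the vanishing defect, to `W` itself
— so `W` is `F`-invariant on the germ, on the past (`dss_of_germ`), zero (past Liouville), and `u ≡ 0` (one-limit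
Liouville).  Rows: `Row_A2huD` (×2×3 defects, DECIDED), `Row_A2huDf` (one FINE factor, DECIDED via D5r), `Row_A2huDL`
(one COARSE factor: OPEN, PROVED `↔ CoarsePastLiouville`, the same D7 wall); the defect rows DOMINATE the convergence rows
of REV 1 (`row_A2huN_of_D`, `row_A2huR_of_D`, `row_A2huL_of_DL`). -/

/-- **DEFECT MASTER THEOREM.**  `F` positive factors with the past Liouville property at `C`; `sₖ → ∞` ANY scale
sequence; if for every `c ∈ F` and every `x` in a nonempty open `U` the finite difference
`u_{c sₖ}(t₀, x) − u_{sₖ}(t₀, x) → 0` (ONE time `t₀ < 0`), then `u ≡ 0` on the past. -/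
theorem eq_zero_of_zoomDefect {F : Set ℝ} (hFpos : ∀ c ∈ F, 0 < c) (hF : PastLiouville C F)
    (hu : IsTypeIAncientMild C u) {s : ℕ → ℝ} (hspos : ∀ k, 0 < s k) (hslim : Tendsto s atTop atTop)
    {t₀ : ℝ} (ht₀ : t₀ < 0) {U : Set E3} (hU : IsOpen U) (hne : U.Nonempty)
    (hdef : ∀ c ∈ F, ∀ x ∈ U,
      Tendsto (fun k => nsRescale (c * s k) u t₀ x - nsRescale (s k) u t₀ x) atTop (𝓝 0)) :
    ∀ t < 0, ∀ x, u t x = 0 := by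
  obtain ⟨φ, hφ, W, hWh, hW, hpt, -⟩ := exists_hull_limit hu hspos hslim
  -- on the germ, `W` is invariant under the zoom by every `c ∈ F`
  have hgerm : ∀ c ∈ F, ∀ x ∈ U, nsRescale c W t₀ x = W t₀ x := by
    intro c hc x hx
    have hct : c ^ 2 * t₀ < 0 := mul_neg_of_pos_of_neg (by positivity [hFpos c hc]) ht₀
    have hA : Tendsto (fun j => nsRescale (c * s (φ j)) u t₀ x) atTop (𝓝 (nsRescale c W t₀ x)) := by
      have h1 : Tendsto (fun j => c • nsRescale (s (φ j)) u (c ^ 2 * t₀) (c • x)) atTop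
          (𝓝 (c • W (c ^ 2 * t₀) (c • x))) := (hpt _ hct _).const_smul c
      show Tendsto (fun j => nsRescale (c * s (φ j)) u t₀ x) atTop (𝓝 (c • W (c ^ 2 * t₀) (c • x)))
      refine h1.congr fun j => ?_
      rw [mul_comm c, nsRescale_mul]
      rfl
    have hB : Tendsto (fun j => nsRescale (s (φ j)) u t₀ x +
        (nsRescale (c * s (φ j)) u t₀ x - nsRescale (s (φ j)) u t₀ x)) atTop (𝓝 (W t₀ x + 0)) :=
      (hpt t₀ ht₀ x).add ((hdef c hc x hx).comp hφ.tendsto_atTop)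
    rw [add_zero] at hB
    have hB' : Tendsto (fun j => nsRescale (c * s (φ j)) u t₀ x) atTop (𝓝 (W t₀ x)) :=
      hB.congr fun j => by abel
    exact tendsto_nhds_unique hA hB'
  -- germ invariance ⇒ past invariance ⇒ `W ≡ 0` ⇒ `u ≡ 0`
  have hinv : PastInvariant F W := fun c hc t ht x =>
    dss_of_germ hW (hFpos c hc) ht₀ hU hne (hgerm c hc) ht x
  exact eq_zero_of_zero_mem_hull hu hWh (hF W hW hinv)

/-- The defect hypothesis at factor `c` along a scale sequence, on a germ `U × {t₀}`. -/
def DefectVanishes (c : ℝ) (u : ℝ → E3 → E3) (s : ℕ → ℝ) (t₀ : ℝ) (U : Set E3) : Prop :=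
  ∀ x ∈ U, Tendsto (fun k => nsRescale (c * s k) u t₀ x - nsRescale (s k) u t₀ x) atTop (𝓝 0)

/-- **Row A2huD** («×2 and ×3 zoom DEFECTS vanish along ONE scale sequence on ONE slice-germ»).  DECIDED (`row_A2huD_holds`). -/
def Row_A2huD : Prop :=
  ∀ (C : ℝ) (u : ℝ → E3 → E3), IsTypeIAncientMild C u →
    (∃ s : ℕ → ℝ, (∀ k, 0 < s k) ∧ Tendsto s atTop atTop ∧ ∃ t₀ < (0 : ℝ), ∃ U : Set E3, IsOpen U ∧ U.Nonempty ∧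
      DefectVanishes 2 u s t₀ U ∧ DefectVanishes 3 u s t₀ U) →
    ∀ t < (0 : ℝ), ∀ x, u t x = 0

/-- **Row A2huDf** («one FINE-factor defect vanishes along one sequence», `1 < λ < c₁(C)`).  DECIDED (`row_A2huDf_holds`). -/
def Row_A2huDf : Prop :=
  ∀ C : ℝ, ∃ c₁ : ℝ, 1 < c₁ ∧ ∀ u : ℝ → E3 → E3, IsTypeIAncientMild C u →
    (∃ lam : ℝ, 1 < lam ∧ lam < c₁ ∧ ∃ s : ℕ → ℝ, (∀ k, 0 < s k) ∧ Tendsto s atTop atTop ∧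
      ∃ t₀ < (0 : ℝ), ∃ U : Set E3, IsOpen U ∧ U.Nonempty ∧ DefectVanishes lam u s t₀ U) →
    ∀ t < (0 : ℝ), ∀ x, u t x = 0

/-- **Row A2huDL** («one COARSE-factor defect vanishes along one sequence», ANY `λ > 1`).  OPEN — PROVED
`↔ CoarsePastLiouville` (`row_A2huDL_iff`): the same D7 wall as `Row_A2huL` and `CoarseGapLaw`. -/
@[conjecture] def Row_A2huDL : Prop :=
  ∀ (C : ℝ) (u : ℝ → E3 → E3), IsTypeIAncientMild C u →
    (∃ lam : ℝ, 1 < lam ∧ ∃ s : ℕ → ℝ, (∀ k, 0 < s k) ∧ Tendsto s atTop atTop ∧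
      ∃ t₀ < (0 : ℝ), ∃ U : Set E3, IsOpen U ∧ U.Nonempty ∧ DefectVanishes lam u s t₀ U) →
    ∀ t < (0 : ℝ), ∀ x, u t x = 0

/-- **Row A2huD holds.** -/
theorem row_A2huD_holds : Row_A2huD := by
  rintro C u hu ⟨s, hspos, hslim, t₀, ht₀, U, hU, hne, h2, h3⟩
  refine eq_zero_of_zoomDefect (F := {2, 3}) ?_ (pastLiouville_two_three C) hu hspos hslim ht₀ hU hne ?_
  · intro c hc
    rcases hc with rfl | rfl <;> norm_num
  · intro c hc x hx
    rcases hc with rfl | rfl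
    · exact h2 x hx
    · exact h3 x hx

/-- **Row A2huDf holds.** -/
theorem row_A2huDf_holds : Row_A2huDf := fun C => by
  obtain ⟨c₁, hc₁, H⟩ := pastLiouville_nearOne C
  refine ⟨c₁, hc₁, ?_⟩
  rintro u hu ⟨lam, h1, h2, s, hspos, hslim, t₀, ht₀, U, hU, hne, hd⟩
  exact eq_zero_of_zoomDefect (F := {lam}) (by simpa using one_pos.trans h1) (H lam h1 h2) hu hspos hslim ht₀ hU hne
    (fun c hc x hx => by rw [mem_singleton_iff] at hc; subst hc; exact hd x hx)

/-- The coarse defect row is EXACTLY the coarse past Liouville (census D7, past form). -/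
theorem row_A2huDL_iff : Row_A2huDL ↔ CoarsePastLiouville := by
  constructor
  · intro h C lam hlam W hW hinv
    -- a past-invariant `W` has identically vanishing `λ`-defects along every scale sequence
    refine h C W hW ⟨lam, hlam, fun k => (k : ℝ) + 1, fun k => by positivity,
      tendsto_natCast_atTop_atTop.atTop_add tendsto_const_nhds, -1, by norm_num, univ, isOpen_univ, univ_nonempty,
      fun x _ => ?_⟩
    have hz : ∀ k : ℕ, nsRescale (lam * ((k : ℝ) + 1)) W (-1) x - nsRescale ((k : ℝ) + 1) W (-1) x = 0 := by
      intro k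
      have hμt : ((k : ℝ) + 1) ^ 2 * (-1 : ℝ) < 0 := mul_neg_of_pos_of_neg (by positivity) (by norm_num)
      rw [nsRescale_mul, nsRescale_apply, hinv lam rfl _ hμt, ← nsRescale_apply, sub_self]
    simp_rw [hz]
    exact tendsto_const_nhds
  · rintro h C u hu ⟨lam, hlam, s, hspos, hslim, t₀, ht₀, U, hU, hne, hd⟩
    exact eq_zero_of_zoomDefect (F := {lam}) (by simpa using one_pos.trans hlam) (h C lam hlam) hu hspos hslim ht₀
      hU hne (fun c hc x hx => by rw [mem_singleton_iff] at hc; subst hc; exact hd x hx)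

/-- NESTING: the defect row DOMINATES the ℕ-convergence row of REV 1 (convergent zooms have vanishing defects). -/
theorem row_A2huN_of_D (h : Row_A2huD) : Row_A2huN := by
  rintro C u hu ⟨t₀, ht₀, U, hU, hne, w, hconv⟩
  refine h C u hu ⟨fun k => (k : ℝ) + 1, fun k => by positivity,
    tendsto_natCast_atTop_atTop.atTop_add tendsto_const_nhds, t₀, ht₀, U, hU, hne, ?_, ?_⟩
  all_goals
    intro x hx
    have hc := hconv x hx
    -- along `n + 1` and along `c (n + 1)` (c = 2, 3) the integer zooms converge to the same `w x`
    have h1 : Tendsto (fun k : ℕ => nsRescale ((k : ℝ) + 1) u t₀ x) atTop (𝓝 (w x)) := by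
      have := hc.comp (tendsto_add_atTop_nat 1)
      refine this.congr fun k => ?_
      simp [Function.comp, Nat.cast_add, Nat.cast_one]
  · have h2 : Tendsto (fun k : ℕ => nsRescale (2 * ((k : ℝ) + 1)) u t₀ x) atTop (𝓝 (w x)) := by
      have hφ : Tendsto (fun k : ℕ => 2 * (k + 1)) atTop atTop :=
        (tendsto_add_atTop_nat 1).const_mul_atTop' two_pos
      refine (hc.comp hφ).congr fun k => ?_
      simp [Function.comp, Nat.cast_add, Nat.cast_mul, Nat.cast_one, Nat.cast_ofNat]
    have := h2.sub h1
    rwa [sub_self] at this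
  · have h3 : Tendsto (fun k : ℕ => nsRescale (3 * ((k : ℝ) + 1)) u t₀ x) atTop (𝓝 (w x)) := by
      have hφ : Tendsto (fun k : ℕ => 3 * (k + 1)) atTop atTop :=
        (tendsto_add_atTop_nat 1).const_mul_atTop' three_pos
      refine (hc.comp hφ).congr fun k => ?_
      simp [Function.comp, Nat.cast_add, Nat.cast_mul, Nat.cast_one, Nat.cast_ofNat]
    have := h3.sub h1
    rwa [sub_self] at this

/-- NESTING: the coarse defect row dominates the coarse convergence row of REV 1 (same wall, weaker hypothesis). -/
theorem row_A2huL_of_DL (h : Row_A2huDL) : Row_A2huL := by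
  rintro C u hu ⟨lam, hlam, t₀, ht₀, U, hU, hne, w, hconv⟩
  have hpos : 0 < lam := one_pos.trans hlam
  refine h C u hu ⟨lam, hlam, fun k => lam ^ k, fun k => pow_pos hpos k, tendsto_pow_atTop_atTop_of_one_lt hlam,
    t₀, ht₀, U, hU, hne, fun x hx => ?_⟩
  have h1 := hconv x hx
  have h2 : Tendsto (fun k : ℕ => nsRescale (lam * lam ^ k) u t₀ x) atTop (𝓝 (w x)) := by
    refine (h1.comp (tendsto_add_atTop_nat 1)).congr fun k => ?_
    simp [Function.comp, pow_succ, mul_comm]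
  have := h2.sub h1
  rwa [sub_self] at this

end Summit.NavierStokesRegularity.NavierStokesRegularity.Theorems.ScenarioCensus.HullMeter

end
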